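import Literature.MathematicalPhysics.QuantumLattice.TorusBandIntegratedDensity
import HarnessLib

/-!
# A chemical-potential window for the fillings `[3/10, 9/20]` of the square-lattice band

Topic `MathematicalPhysics/QuantumLattice`. For the integrated density of states
`N(E) = vol {v ∈ [0,1)² | -2(cos 2πv₁ + cos 2πv₂) ≤ E}` of the nearest-neighbour band (continuous by
`TorusBandIntegratedDensity.lean`) we PROVE two explicit bounds strictly inside the band `(-4, 0)`
below half filling:

* `volume_real_sublevelCell_neg_three_le` — `N(-3) ≤ 1/9` (below `-3` both `cos 2πvᵢ ≥ 1/2`, so each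
  coordinate is within `1/6` of an integer);
* `le_volume_real_sublevelCell_hi` — `N(-4 sin²(π/50)) ≥ 287/625 > 9/20` (above that energy the
  sum-to-product formula confines `v` to the rotated square `|v₁ + v₂ - 1|, |v₁ - v₂| < 13/25`
  around the band maximum, of area `338/625` by a linear change of variables of determinant `-2`);

hence, by the intermediate value theorem, every filling fraction `t ∈ [3/10, 9/20]` (per spin; the
dopings `δ = 1 - 2t ∈ [1/10, 2/5]` of the route `ThermalWedge` of `HubbardSuperconductivity`) is
`N(μ)` for some `μ ∈ [-3, -4 sin²(π/50)] ⊂ (-4, 0)` (`exists_energy_of_filling`), and with the Weyl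
law: `#{k ∈ (ℤ/Lℤ)² : ε_L(k) ≤ μ}/L² → t` (`exists_window_tendsto_torusLevelCount`). The constants
are not optimised. No definition is introduced. [folklore]
-/

noncomputable section

open MeasureTheory Submodule Filter Topology Bornology Finset
open Literature.Probability.LatticeModels
open scoped Pointwise

namespace Literature.MathematicalPhysics.QuantumLattice
/-! ### The filling window: explicit energies bracketing the fillings `[3/10, 9/20]` -/

section Window

/-- `cos (2πv) < 1/2` for `v ∈ (1/6, 5/6)`. [folklore] -/
theorem cos_two_pi_mul_lt_half {v : ℝ} (h1 : 1 / 6 < v) (h2 : v < 5 / 6) :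
    Real.cos (2 * Real.pi * v) < 1 / 2 := by
  have hπ := Real.pi_pos
  rw [← Real.cos_pi_div_three]
  rcases le_or_gt (2 * Real.pi * v) Real.pi with hle | hgt
  · exact Real.cos_lt_cos_of_nonneg_of_le_pi (by positivity) hle (by nlinarith)
  · have heq : Real.cos (2 * Real.pi * v) = Real.cos (2 * Real.pi - 2 * Real.pi * v) := by
      rw [Real.cos_sub, Real.cos_two_pi, Real.sin_two_pi]; ring
    rw [heq]
    exact Real.cos_lt_cos_of_nonneg_of_le_pi (by positivity) (by nlinarith) (by nlinarith)

/-- Below the energy `-3` every coordinate of a point of the sublevel cell is within `1/6` of an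
integer. [folklore] -/
theorem sublevelCell_neg_three_subset :
    {v : Fin 2 → ℝ | (∀ i, v i ∈ Set.Ico (0 : ℝ) 1) ∧
        -2 * ∑ i : Fin 2, Real.cos (2 * Real.pi * v i) ≤ -3} ⊆
      Set.univ.pi fun _ : Fin 2 => Set.Icc (0 : ℝ) (1 / 6) ∪ Set.Icc (5 / 6) 1 := by
  intro v hv
  obtain ⟨hbox, hband⟩ := hv
  rw [Fin.sum_univ_two] at hband
  have hc0 := Real.cos_le_one (2 * Real.pi * v 0)
  have hc1 := Real.cos_le_one (2 * Real.pi * v 1)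
  have hge : ∀ i : Fin 2, 1 / 2 ≤ Real.cos (2 * Real.pi * v i) := by
    intro i
    fin_cases i
    · show 1 / 2 ≤ Real.cos (2 * Real.pi * v 0); linarith
    · show 1 / 2 ≤ Real.cos (2 * Real.pi * v 1); linarith
  simp only [Set.mem_univ_pi, Set.mem_union, Set.mem_Icc]
  intro i
  have h := hge i
  have hb := hbox i
  by_cases h6 : v i ≤ 1 / 6
  · exact Or.inl ⟨hb.1, h6⟩
  · right
    refine ⟨?_, hb.2.le⟩
    by_contra h56
    exact absurd h (not_le.2 (cos_two_pi_mul_lt_half (not_le.1 h6) (not_le.1 h56)))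

/-- **Lower edge of the window**: the integrated density of states at `E = -3` is at most `1/9`.
[folklore] -/
theorem volume_real_sublevelCell_neg_three_le :
    volume.real {v : Fin 2 → ℝ | (∀ i, v i ∈ Set.Ico (0 : ℝ) 1) ∧
        -2 * ∑ i : Fin 2, Real.cos (2 * Real.pi * v i) ≤ -3} ≤ 1 / 9 := by
  rw [measureReal_def]
  refine ENNReal.toReal_le_of_le_ofReal (by norm_num) ?_
  refine (measure_mono sublevelCell_neg_three_subset).trans ?_
  rw [volume_pi, Measure.pi_pi, Fin.prod_univ_two]
  have h1 : volume (Set.Icc (0 : ℝ) (1 / 6) ∪ Set.Icc (5 / 6) 1) ≤ ENNReal.ofReal (1 / 3) := by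
    refine (measure_union_le _ _).trans ?_
    rw [Real.volume_Icc, Real.volume_Icc, ← ENNReal.ofReal_add (by norm_num) (by norm_num)]
    exact ENNReal.ofReal_le_ofReal (by norm_num)
  calc volume (Set.Icc (0 : ℝ) (1 / 6) ∪ Set.Icc (5 / 6) 1) *
        volume (Set.Icc (0 : ℝ) (1 / 6) ∪ Set.Icc (5 / 6) 1)
      ≤ ENNReal.ofReal (1 / 3) * ENNReal.ofReal (1 / 3) := mul_le_mul' h1 h1
    _ = ENNReal.ofReal (1 / 9) := by
        rw [← ENNReal.ofReal_mul (by norm_num)]; norm_num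

/-- Sum-to-product exclusion: for `a, b ∈ [-π, π]`, `0 ≤ τ ≤ π` and `|a + b| ≥ π + τ`,
`cos a + cos b ≤ -2 sin²(τ/2)`. [folklore] -/
theorem cos_add_cos_le_of_abs_add_ge {a b τ : ℝ} (ha : |a| ≤ Real.pi) (hb : |b| ≤ Real.pi)
    (hτ0 : 0 ≤ τ) (hτ : τ ≤ Real.pi) (hab : Real.pi + τ ≤ |a + b|) :
    Real.cos a + Real.cos b ≤ -2 * Real.sin (τ / 2) ^ 2 := by
  have hπ := Real.pi_pos
  rw [Real.cos_add_cos]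
  rw [abs_le] at ha hb
  -- `|a + b| + |a - b| ≤ 2π`
  have hsum : |a + b| + |a - b| ≤ 2 * Real.pi := by
    rcases abs_cases (a + b) with ⟨h1, _⟩ | ⟨h1, _⟩ <;>
      rcases abs_cases (a - b) with ⟨h2, _⟩ | ⟨h2, _⟩ <;> linarith
  have hp : (Real.pi + τ) / 2 ≤ |(a + b) / 2| := by
    rw [abs_div, abs_two]; linarith
  have hpπ : |(a + b) / 2| ≤ Real.pi := by
    rw [abs_div, abs_two]
    have : |a + b| ≤ 2 * Real.pi := by linarith [abs_nonneg (a - b)]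
    linarith
  have hq : |(a - b) / 2| ≤ (Real.pi - τ) / 2 := by
    rw [abs_div, abs_two]; linarith
  -- `cos ((a+b)/2) ≤ -sin (τ/2)`
  have hcp : Real.cos ((a + b) / 2) ≤ -Real.sin (τ / 2) := by
    rw [← Real.cos_abs ((a + b) / 2)]
    have := Real.cos_le_cos_of_nonneg_of_le_pi (by positivity) hpπ hp
    rw [show (Real.pi + τ) / 2 = τ / 2 + Real.pi / 2 by ring, Real.cos_add_pi_div_two] at this
    exact this
  -- `cos ((a-b)/2) ≥ sin (τ/2) ≥ 0`
  have hcq : Real.sin (τ / 2) ≤ Real.cos ((a - b) / 2) := by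
    rw [← Real.cos_abs ((a - b) / 2)]
    have := Real.cos_le_cos_of_nonneg_of_le_pi (abs_nonneg _) (by linarith) hq
    rw [show (Real.pi - τ) / 2 = Real.pi / 2 - τ / 2 by ring, Real.cos_pi_div_two_sub] at this
    exact this
  have hs0 : 0 ≤ Real.sin (τ / 2) :=
    Real.sin_nonneg_of_nonneg_of_le_pi (by positivity) (by linarith)
  nlinarith [mul_le_mul_of_nonneg_right hcp (hs0.trans hcq),
    mul_le_mul_of_nonpos_left hcq (neg_nonpos.2 hs0)]

/-- The same exclusion with `|a - b| ≥ π + τ`. [folklore] -/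
theorem cos_add_cos_le_of_abs_sub_ge {a b τ : ℝ} (ha : |a| ≤ Real.pi) (hb : |b| ≤ Real.pi)
    (hτ0 : 0 ≤ τ) (hτ : τ ≤ Real.pi) (hab : Real.pi + τ ≤ |a - b|) :
    Real.cos a + Real.cos b ≤ -2 * Real.sin (τ / 2) ^ 2 := by
  have h := cos_add_cos_le_of_abs_add_ge (b := -b) ha (by rwa [abs_neg]) hτ0 hτ
    (by rwa [← sub_eq_add_neg])
  rwa [Real.cos_neg] at h

/-- Above the energy `E_hi = -4 sin²(π/50) < 0`, the points of the unit cell lie in the rotated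
square `|v₀ + v₁ - 1| < 13/25`, `|v₀ - v₁| < 13/25` around the band maximum. [folklore] -/
theorem superlevelCell_subset_rotatedSquare :
    {v : Fin 2 → ℝ | (∀ i, v i ∈ Set.Ico (0 : ℝ) 1) ∧
        -4 * Real.sin (Real.pi / 50) ^ 2 < -2 * ∑ i : Fin 2, Real.cos (2 * Real.pi * v i)} ⊆
      {v : Fin 2 → ℝ | |v 0 + v 1 - 1| < 13 / 25 ∧ |v 0 - v 1| < 13 / 25} := by
  intro v hv
  obtain ⟨hbox, hband⟩ := hv
  rw [Fin.sum_univ_two] at hband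
  have hπ := Real.pi_pos
  set a : ℝ := 2 * Real.pi * v 0 - Real.pi with ha
  set b : ℝ := 2 * Real.pi * v 1 - Real.pi with hb
  have ha' : |a| ≤ Real.pi := by
    rw [abs_le]; obtain ⟨h0, h1⟩ := hbox 0; constructor <;> nlinarith
  have hb' : |b| ≤ Real.pi := by
    rw [abs_le]; obtain ⟨h0, h1⟩ := hbox 1; constructor <;> nlinarith
  have hca : Real.cos (2 * Real.pi * v 0) = -Real.cos a := by
    rw [ha, Real.cos_sub_pi, neg_neg]
  have hcb : Real.cos (2 * Real.pi * v 1) = -Real.cos b := by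
    rw [hb, Real.cos_sub_pi, neg_neg]
  rw [hca, hcb] at hband
  -- so `cos a + cos b > -2 sin²(π/50)`; both exclusions are contradicted
  have hτ0 : (0 : ℝ) ≤ Real.pi / 25 := by positivity
  have hτ : Real.pi / 25 ≤ Real.pi := by linarith
  have key : ¬ (Real.cos a + Real.cos b ≤ -2 * Real.sin (Real.pi / 50) ^ 2) := by
    intro h; linarith
  simp only [Set.mem_setOf_eq]
  constructor
  · by_contra hge
    rw [not_lt] at hge
    refine key ?_
    have h50 : Real.pi / 25 / 2 = Real.pi / 50 := by ring
    rw [← h50]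
    refine cos_add_cos_le_of_abs_add_ge ha' hb' hτ0 hτ ?_
    have : a + b = 2 * Real.pi * (v 0 + v 1 - 1) := by rw [ha, hb]; ring
    rw [this, abs_mul, abs_of_pos (by positivity : (0 : ℝ) < 2 * Real.pi)]
    nlinarith
  · by_contra hge
    rw [not_lt] at hge
    refine key ?_
    have h50 : Real.pi / 25 / 2 = Real.pi / 50 := by ring
    rw [← h50]
    refine cos_add_cos_le_of_abs_sub_ge ha' hb' hτ0 hτ ?_
    have : a - b = 2 * Real.pi * (v 0 - v 1) := by rw [ha, hb]; ring
    rw [this, abs_mul, abs_of_pos (by positivity : (0 : ℝ) < 2 * Real.pi)]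
    nlinarith

/-- The rotated square has volume `338/625` (a linear change of variables of determinant `-2` from
the square `(-13/25, 13/25)²`, translated to the centre of the cell). [folklore] -/
theorem volume_rotatedSquare :
    volume {v : Fin 2 → ℝ | |v 0 + v 1 - 1| < 13 / 25 ∧ |v 0 - v 1| < 13 / 25} =
      ENNReal.ofReal (338 / 625) := by
  -- translate to the origin
  set c : Fin 2 → ℝ := fun _ => 1 / 2 with hc
  set R₀ : Set (Fin 2 → ℝ) := {w | |w 0 + w 1| < 13 / 25 ∧ |w 0 - w 1| < 13 / 25} with hR₀
  have htr : {v : Fin 2 → ℝ | |v 0 + v 1 - 1| < 13 / 25 ∧ |v 0 - v 1| < 13 / 25} =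
      (fun v => v + -c) ⁻¹' R₀ := by
    ext v
    simp only [hR₀, hc, Set.mem_setOf_eq, Set.mem_preimage, Pi.add_apply, Pi.neg_apply]
    have e1 : v 0 + -(1 / 2 : ℝ) + (v 1 + -(1 / 2)) = v 0 + v 1 - 1 := by ring
    have e2 : v 0 + -(1 / 2 : ℝ) - (v 1 + -(1 / 2)) = v 0 - v 1 := by ring
    rw [e1, e2]
  rw [htr, measure_preimage_add_right]
  -- the linear change of variables
  set N : (Fin 2 → ℝ) →ₗ[ℝ] (Fin 2 → ℝ) := Matrix.toLin' !![(1 : ℝ), 1; 1, -1] with hN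
  have hNapp : ∀ w : Fin 2 → ℝ, N w 0 = w 0 + w 1 ∧ N w 1 = w 0 - w 1 := by
    intro w
    simp [hN, Matrix.toLin'_apply, Matrix.mulVec, dotProduct, Fin.sum_univ_two]
    ring
  have hdet : LinearMap.det N = -2 := by
    rw [hN, LinearMap.det_toLin', Matrix.det_fin_two_of]; norm_num
  have hpre : R₀ = N ⁻¹' (Set.univ.pi fun _ : Fin 2 => Set.Ioo (-(13 / 25 : ℝ)) (13 / 25)) := by
    ext w
    simp only [hR₀, Set.mem_setOf_eq, Set.mem_preimage, Set.mem_univ_pi, Set.mem_Ioo,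
      Fin.forall_fin_two, (hNapp w).1, (hNapp w).2, abs_lt]
  rw [hpre, Measure.addHaar_preimage_linearMap _ (by rw [hdet]; norm_num), hdet, volume_pi,
    Measure.pi_pi, Fin.prod_univ_two, Real.volume_Ioo,
    ← ENNReal.ofReal_mul (by norm_num), ← ENNReal.ofReal_mul (by norm_num)]
  norm_num

/-- **Upper edge of the window**: at `E_hi = -4 sin²(π/50) < 0` the integrated density of states
is at least `287/625 > 9/20`. [folklore] -/
theorem le_volume_real_sublevelCell_hi :
    287 / 625 ≤ volume.real {v : Fin 2 → ℝ | (∀ i, v i ∈ Set.Ico (0 : ℝ) 1) ∧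
        -2 * ∑ i : Fin 2, Real.cos (2 * Real.pi * v i) ≤ -4 * Real.sin (Real.pi / 50) ^ 2} := by
  have hcover : {v : Fin 2 → ℝ | ∀ i, v i ∈ Set.Ico (0 : ℝ) 1} ⊆
      {v : Fin 2 → ℝ | (∀ i, v i ∈ Set.Ico (0 : ℝ) 1) ∧
        -2 * ∑ i : Fin 2, Real.cos (2 * Real.pi * v i) ≤ -4 * Real.sin (Real.pi / 50) ^ 2} ∪
      {v : Fin 2 → ℝ | |v 0 + v 1 - 1| < 13 / 25 ∧ |v 0 - v 1| < 13 / 25} := by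
    intro v hv
    by_cases h : -2 * ∑ i : Fin 2, Real.cos (2 * Real.pi * v i) ≤ -4 * Real.sin (Real.pi / 50) ^ 2
    · exact Or.inl ⟨hv, h⟩
    · exact Or.inr (superlevelCell_subset_rotatedSquare ⟨hv, not_le.1 h⟩)
  have h1 : (1 : ENNReal) ≤ volume {v : Fin 2 → ℝ | (∀ i, v i ∈ Set.Ico (0 : ℝ) 1) ∧
        -2 * ∑ i : Fin 2, Real.cos (2 * Real.pi * v i) ≤ -4 * Real.sin (Real.pi / 50) ^ 2} +
      ENNReal.ofReal (338 / 625) := by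
    rw [← volume_unitCell, ← volume_rotatedSquare]
    exact (measure_mono hcover).trans (measure_union_le _ _)
  rw [measureReal_def, ← ENNReal.ofReal_le_iff_le_toReal (volume_sublevelCell_ne_top _)]
  have h2 : ENNReal.ofReal (287 / 625) = 1 - ENNReal.ofReal (338 / 625) := by
    rw [← ENNReal.ofReal_one, ← ENNReal.ofReal_sub _ (by norm_num)]; norm_num
  rw [h2]
  exact tsub_le_iff_right.2 h1

/-- `E_hi = -4 sin²(π/50)` is negative. [folklore] -/
theorem energyHi_neg : -4 * Real.sin (Real.pi / 50) ^ 2 < 0 := by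
  have : 0 < Real.sin (Real.pi / 50) :=
    Real.sin_pos_of_pos_of_lt_pi (by positivity) (by linarith [Real.pi_pos])
  nlinarith

/-- `-3 ≤ E_hi`. [folklore] -/
theorem neg_three_le_energyHi : (-3 : ℝ) ≤ -4 * Real.sin (Real.pi / 50) ^ 2 := by
  have h1 : Real.sin (Real.pi / 50) ≤ Real.pi / 50 := Real.sin_le (by positivity)
  have h2 : 0 ≤ Real.sin (Real.pi / 50) :=
    (Real.sin_pos_of_pos_of_lt_pi (by positivity) (by linarith [Real.pi_pos])).le
  have h3 : Real.pi / 50 ≤ 1 / 2 := by linarith [Real.pi_lt_four]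
  nlinarith

/-- **Every filling in `[3/10, 9/20]` per spin is realised by an energy in the window
`[-3, -4 sin²(π/50)] ⊂ (-4, 0)`** (intermediate value theorem for the continuous integrated
density of states). [folklore] -/
theorem exists_energy_of_filling {t : ℝ} (ht : t ∈ Set.Icc (3 / 10 : ℝ) (9 / 20)) :
    ∃ μ ∈ Set.Icc (-3 : ℝ) (-4 * Real.sin (Real.pi / 50) ^ 2),
      volume.real {v : Fin 2 → ℝ | (∀ i, v i ∈ Set.Ico (0 : ℝ) 1) ∧
        -2 * ∑ i : Fin 2, Real.cos (2 * Real.pi * v i) ≤ μ} = t := by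
  have hIVT := intermediate_value_Icc neg_three_le_energyHi
    (continuous_volume_real_sublevelCell.continuousOn)
  have hlo := volume_real_sublevelCell_neg_three_le
  have hhi := le_volume_real_sublevelCell_hi
  obtain ⟨μ, hμ, hμt⟩ := hIVT (show t ∈ Set.Icc _ _ from ⟨by linarith [ht.1], by linarith [ht.2]⟩)
  exact ⟨μ, hμ, hμt⟩

/-- **The chemical-potential window of the Weyl law.** There are `-4 < μ₁ ≤ μ₂ < 0` (namely
`μ₁ = -3`, `μ₂ = -4 sin²(π/50)`) such that every filling fraction `t ∈ [3/10, 9/20]` of the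
Brillouin zone is the limiting fraction of torus levels below some `μ ∈ [μ₁, μ₂]`:
`#{k ∈ (ℤ/Lℤ)² : ε_L(k) ≤ μ} / L² → t`. [folklore] -/
theorem exists_window_tendsto_torusLevelCount :
    ∃ μ₁ μ₂ : ℝ, -4 < μ₁ ∧ μ₁ ≤ μ₂ ∧ μ₂ < 0 ∧ ∀ t ∈ Set.Icc (3 / 10 : ℝ) (9 / 20),
      ∃ μ ∈ Set.Icc μ₁ μ₂, Tendsto (fun L : ℕ => (torusLevelCount (L + 1) μ : ℝ) /
        (((L + 1 : ℕ) : ℝ) ^ 2)) atTop (𝓝 t) := by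
  refine ⟨-3, -4 * Real.sin (Real.pi / 50) ^ 2, by norm_num, neg_three_le_energyHi, energyHi_neg,
    fun t ht => ?_⟩
  obtain ⟨μ, hμ, hμt⟩ := exists_energy_of_filling ht
  exact ⟨μ, hμ, hμt ▸ tendsto_torusLevelCount_div_sq μ⟩

end Window


end Literature.MathematicalPhysics.QuantumLattice
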